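import Summits.BirchSwinnertonDyer.Rank1Residual.X12.InertBadThreeRecords
import Summits.BirchSwinnertonDyer.Rank1Residual.X12.GoodTwistRecordsD7D8
import Summits.BirchSwinnertonDyer.Rank1Residual.X11b.ChaPairsMinimality
import Summits.BirchSwinnertonDyer.BirchSwinnertonDyer.Theorems.Rank1ResidualX11RankOneMinimality
import HarnessLib

/-!
# X12, `p = 3` inert-bad window: per-curve records (A) — route T-KR at `p = 3` for `288a1, 441d1, 576h1, 2304a1/b1/p1, 7200a1`
# (cell `b2b-bsdres`, unit `b2b-bsdres-x1b`, gen 12)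

HONEST FRAMING (cell `b2b-bsdres`, run/shared/lean/b2b/bsd-rank1-residual/, verbatim in every
file): the goal of the cell is to DELETE the COMBINATION-SHAPED residual classes of the
Birch–Swinnerton-Dyer formula for ALL analytic-rank `≤ 1` elliptic curves over `ℚ` — "full BSD
formula for every rank `≤ 1` curve in class `C`" assembled STRICTLY from published theorems — so
that the rank-`≤ 1` remainder becomes exactly the CONSTRUCTION-SHAPED classes, which are TYPED
(missing-input `Prop`s), NOT attempted. This is not "finishing BSD". Unit `b2b-bsdres-x1b`
(CLASS-OWNERS row "X12 inert-bad core", prover owner), generation 12; research route, no claim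
beyond the stated class; X12 REMAINS CONSTRUCTION-SHAPED; nothing is booked (the lane books, the
referee rules). PER-PAIR records in the style of `X12/GoodTwistRecordsD7D8.lean` /
`X12/MillerStollRecords.lean`: definitions are the Cremona minimal models (data), theorems only
otherwise; no named fact.

For each listed curve `E` (curve `1` of one of the 21 classes of `cremonaCurveOneX12Three`, the
Agashe–Ribet–Stein 2006 appendix Thm. 5.2 instance p222044) the record `bsdp_three_<label>` reads:
PUBLISHED facts (`hGZ … hCM8`, as in `X12/InertBadOddPrime.lean`) + Cremona's two sentences
(`h26 h52`) + `r_an(E) = 1` + `3 ∤ ∏c_ℓ(E)` + `#Ш(E)_an = q`, `ord_3 q = 0` ⟹ `BSD(E, 3)`, via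
`bsdp_three_of_mem_cremonaCurveOneX12Three_of_shaAn_unit` (p222613). KERNEL THEOREMS here: `E`
elliptic and globally minimal (`discOf`, bounded Kraus criterion by `decide`), `j(E) = 1728` (resp.
`−3375`) hence CM and `3` INERT in the CM field, membership in the list. The three per-pair inputs
left are certified in two engines on all 21 (Cremona `allbsd` ‖ PARI kit j100150;
`HOME/b2b-bsdres-x1b/gen12/census3/`); the lane's certificates are the ones of record.
-/

set_option autoImplicit false

noncomputable section

open scoped Classical

open WeierstrassCurve IsDedekindDomain NumberField Rat.HeightOneSpectrum
  Literature.NumberTheory.EllipticCurves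
  Literature.NumberTheory.EllipticCurves.ModularForms
  Literature.NumberTheory.EllipticCurves.Rank1Residual
  Literature.NumberTheory.EllipticCurves.Rank1Residual.Typed
  Literature.NumberTheory.EllipticCurves.Rank1Residual.X11RankOneCertificates
  Literature.NumberTheory.EllipticCurves.AgasheRibetStein2006
  Literature.NumberTheory.Automorphic
  Summit.BirchSwinnertonDyer.BirchSwinnertonDyer.Rank1Residual.X11RankOne
  Summit.BirchSwinnertonDyer.Rank1Residual.X11b

namespace Summit.BirchSwinnertonDyer.Rank1Residual.X12

/-! ### Class bits at `p = 3` from the `j`-invariant -/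

/-- **`ClassX12 W 3` from CM + analytic rank one + `3` inert in the CM field.** [folklore] -/
theorem classX12_three_of_hasCM_of_cmInert (W : WeierstrassCurve ℚ) [W.IsElliptic]
    (hCM : W.HasCM) (hr : W.analyticRank = 1) (hin : CMInert W 3) : ClassX12 W 3 :=
  ⟨hCM, hr, Or.inr (Or.inl ⟨rfl, hin.2⟩)⟩

/-- A curve with `j = 1728` (CM by `ℤ[i]`, `d_K = −4`) is CM-INERT at `3`. [cite: SilvermanATAEC1994, App. A §3] -/
theorem cmInert_three_of_j_eq_1728 (W : WeierstrassCurve ℚ) [W.IsElliptic] (hj : W.j = 1728) :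
    CMInert W 3 := by
  refine ⟨?_, ?_⟩
  · unfold CMRamified; rw [hj]; norm_num [cmFieldDiscrOfJ]
  · unfold CMSplit; rw [hj]; norm_num [cmFieldDiscrOfJ]; decide

/-- A curve with `j = −3375` (CM by `ℤ[(1+√−7)/2]`, `d_K = −7`) is CM-INERT at `3`. [cite: SilvermanATAEC1994, App. A §3] -/
theorem cmInert_three_of_j_eq_neg3375 (W : WeierstrassCurve ℚ) [W.IsElliptic] (hj : W.j = -3375) :
    CMInert W 3 := by
  refine ⟨?_, ?_⟩
  · unfold CMRamified; rw [hj]; norm_num [cmFieldDiscrOfJ]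
  · unfold CMSplit; rw [hj]; norm_num [cmFieldDiscrOfJ]; decide

/-! ## §1 The curves: models, ellipticity, global minimality, `j`, membership -/

/-! ### `288a1 @ 3` -/
namespace Records

/-- Cremona `288a1 = [0, 0, 0, 3, 0]` (`N = 288 = 2^5·3^2`, `j = 1728`, CM by `ℤ[i]`, `3` inert,
additive at `3`). [cite: Cremona1997, Table 1 (curve 288a1)] -/
def c288a1 : WeierstrassCurve ℚ := ⟨0, 0, 0, 3, 0⟩

/-- `288a1` is an elliptic curve (`Δ = -1728 ≠ 0`). [cite: SilvermanAEC2009, III.1] -/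
instance isElliptic_c288a1 : c288a1.IsElliptic := by
  have h := isElliptic_of_discOf_ne_zero 0 0 0 (3) 0 (by decide); norm_num at h; exact h

set_option maxRecDepth 100000 in
/-- `[0, 0, 0, 3, 0]` is globally minimal (`|Δ| = 2^6·3^3`). [cite: SilvermanAEC2009, VII.1 Remark 1.1] -/
instance isGloballyMinimal_c288a1 : c288a1.IsGloballyMinimal := by
  have h := isGloballyMinimal_of_krausCriterion_bounded 0 0 0 (3) 0 (by decide) (by decide)
    (by decide +kernel)
  norm_num at h; exact h

/-- `j(288a1) = 1728` (`c₄ = -144`, `Δ = -1728`). [cite: Cremona1997, Table 1 (curve 288a1)] -/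
theorem c288a1_j : c288a1.j = 1728 := by
  have hc₄ : c288a1.c₄ = -144 := by
    norm_num [c288a1, WeierstrassCurve.c₄, WeierstrassCurve.b₂, WeierstrassCurve.b₄]
  have hΔ : c288a1.Δ = -1728 := by
    norm_num [c288a1, WeierstrassCurve.Δ, WeierstrassCurve.b₂, WeierstrassCurve.b₄,
      WeierstrassCurve.b₆, WeierstrassCurve.b₈]
  rw [j, Units.inv_mul_eq_iff_eq_mul, hc₄, coe_Δ', hΔ]; norm_num

/-- `(288a1, 288)` is listed in `cremonaCurveOneX12Three`. [cite: AgasheRibetStein2006, appendix Thm. 5.2] -/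
theorem mem_c288a1 : (c288a1, 288) ∈ cremonaCurveOneX12Three := by simp [cremonaCurveOneX12Three, c288a1]
end Records


/-! ### `441d1 @ 3` (`j = −3375`; model, instances from `X12/GoodTwistRecordsD7D8.lean`) -/

namespace Records

/-- `j(441d1) = −3375` (`c₄ = 945`, `Δ = −250047 = −3⁶·7³`). [cite: Cremona1997, Table 1 (curve 441d1)] -/
theorem cremona441d1_j : cremona441d1.j = -3375 := by
  have hc₄ : cremona441d1.c₄ = 945 := by
    norm_num [cremona441d1, WeierstrassCurve.c₄, WeierstrassCurve.b₂, WeierstrassCurve.b₄]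
  have hΔ : cremona441d1.Δ = -250047 := by
    norm_num [cremona441d1, WeierstrassCurve.Δ, WeierstrassCurve.b₂, WeierstrassCurve.b₄,
      WeierstrassCurve.b₆, WeierstrassCurve.b₈]
  rw [j, Units.inv_mul_eq_iff_eq_mul, hc₄, coe_Δ', hΔ]
  norm_num

/-- `(441d1, 441)` is an entry of `cremonaCurveOneX12Three`. [cite: AgasheRibetStein2006, appendix Thm. 5.2] -/
theorem mem_cremona441d1 : (cremona441d1, 441) ∈ cremonaCurveOneX12Three := by
  simp [cremonaCurveOneX12Three, cremona441d1]

end Records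


/-! ### `576h1 @ 3` -/
namespace Records

/-- Cremona `576h1 = [0, 0, 0, 9, 0]` (`N = 576 = 2^6·3^2`, `j = 1728`, CM by `ℤ[i]`, `3` inert,
additive at `3`). [cite: Cremona1997, Table 1 (curve 576h1)] -/
def c576h1 : WeierstrassCurve ℚ := ⟨0, 0, 0, 9, 0⟩

/-- `576h1` is an elliptic curve (`Δ = -46656 ≠ 0`). [cite: SilvermanAEC2009, III.1] -/
instance isElliptic_c576h1 : c576h1.IsElliptic := by
  have h := isElliptic_of_discOf_ne_zero 0 0 0 (9) 0 (by decide); norm_num at h; exact h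

set_option maxRecDepth 100000 in
/-- `[0, 0, 0, 9, 0]` is globally minimal (`|Δ| = 2^6·3^6`). [cite: SilvermanAEC2009, VII.1 Remark 1.1] -/
instance isGloballyMinimal_c576h1 : c576h1.IsGloballyMinimal := by
  have h := isGloballyMinimal_of_krausCriterion_bounded 0 0 0 (9) 0 (by decide) (by decide)
    (by decide +kernel)
  norm_num at h; exact h

/-- `j(576h1) = 1728` (`c₄ = -432`, `Δ = -46656`). [cite: Cremona1997, Table 1 (curve 576h1)] -/
theorem c576h1_j : c576h1.j = 1728 := by
  have hc₄ : c576h1.c₄ = -432 := by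
    norm_num [c576h1, WeierstrassCurve.c₄, WeierstrassCurve.b₂, WeierstrassCurve.b₄]
  have hΔ : c576h1.Δ = -46656 := by
    norm_num [c576h1, WeierstrassCurve.Δ, WeierstrassCurve.b₂, WeierstrassCurve.b₄,
      WeierstrassCurve.b₆, WeierstrassCurve.b₈]
  rw [j, Units.inv_mul_eq_iff_eq_mul, hc₄, coe_Δ', hΔ]; norm_num

/-- `(576h1, 576)` is listed in `cremonaCurveOneX12Three`. [cite: AgasheRibetStein2006, appendix Thm. 5.2] -/
theorem mem_c576h1 : (c576h1, 576) ∈ cremonaCurveOneX12Three := by simp [cremonaCurveOneX12Three, c576h1]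
end Records


/-! ### `2304a1 @ 3` -/
namespace Records

/-- Cremona `2304a1 = [0, 0, 0, -54, 0]` (`N = 2304 = 2^8·3^2`, `j = 1728`, CM by `ℤ[i]`, `3` inert,
additive at `3`). [cite: Cremona1997, Table 1 (curve 2304a1)] -/
def c2304a1 : WeierstrassCurve ℚ := ⟨0, 0, 0, -54, 0⟩

/-- `2304a1` is an elliptic curve (`Δ = 10077696 ≠ 0`). [cite: SilvermanAEC2009, III.1] -/
instance isElliptic_c2304a1 : c2304a1.IsElliptic := by
  have h := isElliptic_of_discOf_ne_zero 0 0 0 (-54) 0 (by decide); norm_num at h; exact h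

set_option maxRecDepth 100000 in
/-- `[0, 0, 0, -54, 0]` is globally minimal (`|Δ| = 2^9·3^9`). [cite: SilvermanAEC2009, VII.1 Remark 1.1] -/
instance isGloballyMinimal_c2304a1 : c2304a1.IsGloballyMinimal := by
  have h := isGloballyMinimal_of_krausCriterion_bounded 0 0 0 (-54) 0 (by decide) (by decide)
    (by decide +kernel)
  norm_num at h; exact h

/-- `j(2304a1) = 1728` (`c₄ = 2592`, `Δ = 10077696`). [cite: Cremona1997, Table 1 (curve 2304a1)] -/
theorem c2304a1_j : c2304a1.j = 1728 := by
  have hc₄ : c2304a1.c₄ = 2592 := by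
    norm_num [c2304a1, WeierstrassCurve.c₄, WeierstrassCurve.b₂, WeierstrassCurve.b₄]
  have hΔ : c2304a1.Δ = 10077696 := by
    norm_num [c2304a1, WeierstrassCurve.Δ, WeierstrassCurve.b₂, WeierstrassCurve.b₄,
      WeierstrassCurve.b₆, WeierstrassCurve.b₈]
  rw [j, Units.inv_mul_eq_iff_eq_mul, hc₄, coe_Δ', hΔ]; norm_num

/-- `(2304a1, 2304)` is listed in `cremonaCurveOneX12Three`. [cite: AgasheRibetStein2006, appendix Thm. 5.2] -/
theorem mem_c2304a1 : (c2304a1, 2304) ∈ cremonaCurveOneX12Three := by simp [cremonaCurveOneX12Three, c2304a1]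
end Records


/-! ### `2304b1 @ 3` -/
namespace Records

/-- Cremona `2304b1 = [0, 0, 0, -6, 0]` (`N = 2304 = 2^8·3^2`, `j = 1728`, CM by `ℤ[i]`, `3` inert,
additive at `3`). [cite: Cremona1997, Table 1 (curve 2304b1)] -/
def c2304b1 : WeierstrassCurve ℚ := ⟨0, 0, 0, -6, 0⟩

/-- `2304b1` is an elliptic curve (`Δ = 13824 ≠ 0`). [cite: SilvermanAEC2009, III.1] -/
instance isElliptic_c2304b1 : c2304b1.IsElliptic := by
  have h := isElliptic_of_discOf_ne_zero 0 0 0 (-6) 0 (by decide); norm_num at h; exact h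

set_option maxRecDepth 100000 in
/-- `[0, 0, 0, -6, 0]` is globally minimal (`|Δ| = 2^9·3^3`). [cite: SilvermanAEC2009, VII.1 Remark 1.1] -/
instance isGloballyMinimal_c2304b1 : c2304b1.IsGloballyMinimal := by
  have h := isGloballyMinimal_of_krausCriterion_bounded 0 0 0 (-6) 0 (by decide) (by decide)
    (by decide +kernel)
  norm_num at h; exact h

/-- `j(2304b1) = 1728` (`c₄ = 288`, `Δ = 13824`). [cite: Cremona1997, Table 1 (curve 2304b1)] -/
theorem c2304b1_j : c2304b1.j = 1728 := by
  have hc₄ : c2304b1.c₄ = 288 := by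
    norm_num [c2304b1, WeierstrassCurve.c₄, WeierstrassCurve.b₂, WeierstrassCurve.b₄]
  have hΔ : c2304b1.Δ = 13824 := by
    norm_num [c2304b1, WeierstrassCurve.Δ, WeierstrassCurve.b₂, WeierstrassCurve.b₄,
      WeierstrassCurve.b₆, WeierstrassCurve.b₈]
  rw [j, Units.inv_mul_eq_iff_eq_mul, hc₄, coe_Δ', hΔ]; norm_num

/-- `(2304b1, 2304)` is listed in `cremonaCurveOneX12Three`. [cite: AgasheRibetStein2006, appendix Thm. 5.2] -/
theorem mem_c2304b1 : (c2304b1, 2304) ∈ cremonaCurveOneX12Three := by simp [cremonaCurveOneX12Three, c2304b1]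
end Records


/-! ### `2304p1 @ 3` -/
namespace Records

/-- Cremona `2304p1 = [0, 0, 0, 18, 0]` (`N = 2304 = 2^8·3^2`, `j = 1728`, CM by `ℤ[i]`, `3` inert,
additive at `3`). [cite: Cremona1997, Table 1 (curve 2304p1)] -/
def c2304p1 : WeierstrassCurve ℚ := ⟨0, 0, 0, 18, 0⟩

/-- `2304p1` is an elliptic curve (`Δ = -373248 ≠ 0`). [cite: SilvermanAEC2009, III.1] -/
instance isElliptic_c2304p1 : c2304p1.IsElliptic := by
  have h := isElliptic_of_discOf_ne_zero 0 0 0 (18) 0 (by decide); norm_num at h; exact h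

set_option maxRecDepth 100000 in
/-- `[0, 0, 0, 18, 0]` is globally minimal (`|Δ| = 2^9·3^6`). [cite: SilvermanAEC2009, VII.1 Remark 1.1] -/
instance isGloballyMinimal_c2304p1 : c2304p1.IsGloballyMinimal := by
  have h := isGloballyMinimal_of_krausCriterion_bounded 0 0 0 (18) 0 (by decide) (by decide)
    (by decide +kernel)
  norm_num at h; exact h

/-- `j(2304p1) = 1728` (`c₄ = -864`, `Δ = -373248`). [cite: Cremona1997, Table 1 (curve 2304p1)] -/
theorem c2304p1_j : c2304p1.j = 1728 := by
  have hc₄ : c2304p1.c₄ = -864 := by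
    norm_num [c2304p1, WeierstrassCurve.c₄, WeierstrassCurve.b₂, WeierstrassCurve.b₄]
  have hΔ : c2304p1.Δ = -373248 := by
    norm_num [c2304p1, WeierstrassCurve.Δ, WeierstrassCurve.b₂, WeierstrassCurve.b₄,
      WeierstrassCurve.b₆, WeierstrassCurve.b₈]
  rw [j, Units.inv_mul_eq_iff_eq_mul, hc₄, coe_Δ', hΔ]; norm_num

/-- `(2304p1, 2304)` is listed in `cremonaCurveOneX12Three`. [cite: AgasheRibetStein2006, appendix Thm. 5.2] -/
theorem mem_c2304p1 : (c2304p1, 2304) ∈ cremonaCurveOneX12Three := by simp [cremonaCurveOneX12Three, c2304p1]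
end Records


/-! ### `7200a1 @ 3` -/
namespace Records

/-- Cremona `7200a1 = [0, 0, 0, 675, 0]` (`N = 7200 = 2^5·3^2·5^2`, `j = 1728`, CM by `ℤ[i]`, `3` inert,
additive at `3`). [cite: Cremona1997, Table 1 (curve 7200a1)] -/
def c7200a1 : WeierstrassCurve ℚ := ⟨0, 0, 0, 675, 0⟩

/-- `7200a1` is an elliptic curve (`Δ = -19683000000 ≠ 0`). [cite: SilvermanAEC2009, III.1] -/
instance isElliptic_c7200a1 : c7200a1.IsElliptic := by
  have h := isElliptic_of_discOf_ne_zero 0 0 0 (675) 0 (by decide); norm_num at h; exact h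

set_option maxRecDepth 100000 in
/-- `[0, 0, 0, 675, 0]` is globally minimal (`|Δ| = 2^6·3^9·5^6`). [cite: SilvermanAEC2009, VII.1 Remark 1.1] -/
instance isGloballyMinimal_c7200a1 : c7200a1.IsGloballyMinimal := by
  have h := isGloballyMinimal_of_krausCriterion_bounded 0 0 0 (675) 0 (by decide) (by decide)
    (by decide +kernel)
  norm_num at h; exact h

/-- `j(7200a1) = 1728` (`c₄ = -32400`, `Δ = -19683000000`). [cite: Cremona1997, Table 1 (curve 7200a1)] -/
theorem c7200a1_j : c7200a1.j = 1728 := by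
  have hc₄ : c7200a1.c₄ = -32400 := by
    norm_num [c7200a1, WeierstrassCurve.c₄, WeierstrassCurve.b₂, WeierstrassCurve.b₄]
  have hΔ : c7200a1.Δ = -19683000000 := by
    norm_num [c7200a1, WeierstrassCurve.Δ, WeierstrassCurve.b₂, WeierstrassCurve.b₄,
      WeierstrassCurve.b₆, WeierstrassCurve.b₈]
  rw [j, Units.inv_mul_eq_iff_eq_mul, hc₄, coe_Δ', hΔ]; norm_num

/-- `(7200a1, 7200)` is listed in `cremonaCurveOneX12Three`. [cite: AgasheRibetStein2006, appendix Thm. 5.2] -/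
theorem mem_c7200a1 : (c7200a1, 7200) ∈ cremonaCurveOneX12Three := by simp [cremonaCurveOneX12Three, c7200a1]
end Records


/-! ## §2 The records -/

section Facts

/-! The PUBLISHED named facts (as in `X12/InertBadOddPrime.lean`) and Cremona's two sentences. -/
variable
  (hGZ : ∀ (N : ℕ) [NeZero N] (W : WeierstrassCurve ℚ) (K : Type) [Field K] [NumberField K],
    gross_zagier N W K)
  (hKo : ∀ (N : ℕ) [NeZero N] (W : WeierstrassCurve ℚ) (K : Type) [Field K] [NumberField K],
    kolyvagin N W K)
  (hMN : ∀ (N : ℕ) [NeZero N] (W : WeierstrassCurve ℚ) (K : Type) [Field K] [NumberField K],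
    MatarNekovar2019.thm03_padicValNat_card_sha_le_of_irreducible N W K)
  (hGZK : rank_eq_analyticRank_of_analyticRank_le_one) (hmod : hasEntireLFunction_rat)
  (hnf : exists_isNewformOf) (hFH : friedbergHoffstein_exists_heegnerField_split_twist_ne_zero)
  (hCM8 : bsdTriple_of_hasCM_of_L_one_ne_zero)
  (h26 : cremona_abs_maninConstant_eq_one_of_level_le) (h52 : cremona_optimal_curveOne_x12Three)

include hGZ hKo hMN hGZK hmod hnf hFH hCM8 h26 h52

/-- **RECORD `288a1 @ 3` (T-KR at `p = 3`)**: PUBLISHED facts + Cremona's Manin table + `r_an = 1` +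
`3 ∤ ∏c_ℓ` + `ord_3 #Ш_an = 0` ⟹ `BSD(288a1, 3)` (CM, `3` inert: `j = 1728`). PER PAIR; nothing booked. [cite: MatarNekovar2019, Thm. 0.3 and §0.11] -/
theorem bsdp_three_c288a1 (hr : Records.c288a1.analyticRank = 1)
    (htam : ¬ 3 ∣ Records.c288a1.tamagawaProduct)
    {q : ℚ} (hq : shaAn Records.c288a1 = (q : ℂ)) (hv : padicValRat 3 q = 0) :
    BSDp Records.c288a1 3 :=
  have hin := cmInert_three_of_j_eq_1728 Records.c288a1 Records.c288a1_j
  bsdp_three_of_mem_cremonaCurveOneX12Three_of_shaAn_unit hGZ hKo hMN hGZK hmod hnf hFH hCM8 h26 h52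
    Records.c288a1 288 Records.mem_c288a1
    (classX12_three_of_hasCM_of_cmInert Records.c288a1 (hasCM_of_j_eq_1728 _ Records.c288a1_j) hr hin)
    hin.1 htam hq hv

/-- **RECORD `441d1 @ 3` (route T-KR at `p = 3`)**: PUBLISHED facts + Cremona's Manin table +
`r_an = 1` + `3 ∤ ∏c_ℓ` + `#Ш_an` a `3`-adic unit ⟹ `BSD(441d1, 3)`; CM by `ℤ[(1+√−7)/2]` and
"`3` inert" are kernel theorems (`j = −3375`). PER PAIR; nothing booked.
[cite: MatarNekovar2019, Thm. 0.3 and §0.11] [cite: AgasheRibetStein2006, Thm. 2.6 and appendix Thm. 5.2]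
[cite: Miller2011LMS, Def. 1.1] -/
theorem bsdp_three_cremona441d1 (hr : Records.cremona441d1.analyticRank = 1)
    (htam : ¬ 3 ∣ Records.cremona441d1.tamagawaProduct)
    {q : ℚ} (hq : shaAn Records.cremona441d1 = (q : ℂ)) (hv : padicValRat 3 q = 0) :
    BSDp Records.cremona441d1 3 :=
  have hin := cmInert_three_of_j_eq_neg3375 Records.cremona441d1 Records.cremona441d1_j
  bsdp_three_of_mem_cremonaCurveOneX12Three_of_shaAn_unit hGZ hKo hMN hGZK hmod hnf hFH hCM8 h26 h52
    Records.cremona441d1 441 Records.mem_cremona441d1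
    (classX12_three_of_hasCM_of_cmInert Records.cremona441d1
      (hasCM_of_j_eq_neg3375 _ Records.cremona441d1_j) hr hin) hin.1 htam hq hv

/-- **RECORD `576h1 @ 3` (T-KR at `p = 3`)**: PUBLISHED facts + Cremona's Manin table + `r_an = 1` +
`3 ∤ ∏c_ℓ` + `ord_3 #Ш_an = 0` ⟹ `BSD(576h1, 3)` (CM, `3` inert: `j = 1728`). PER PAIR; nothing booked. [cite: MatarNekovar2019, Thm. 0.3 and §0.11] -/
theorem bsdp_three_c576h1 (hr : Records.c576h1.analyticRank = 1)
    (htam : ¬ 3 ∣ Records.c576h1.tamagawaProduct)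
    {q : ℚ} (hq : shaAn Records.c576h1 = (q : ℂ)) (hv : padicValRat 3 q = 0) :
    BSDp Records.c576h1 3 :=
  have hin := cmInert_three_of_j_eq_1728 Records.c576h1 Records.c576h1_j
  bsdp_three_of_mem_cremonaCurveOneX12Three_of_shaAn_unit hGZ hKo hMN hGZK hmod hnf hFH hCM8 h26 h52
    Records.c576h1 576 Records.mem_c576h1
    (classX12_three_of_hasCM_of_cmInert Records.c576h1 (hasCM_of_j_eq_1728 _ Records.c576h1_j) hr hin)
    hin.1 htam hq hv

/-- **RECORD `2304a1 @ 3` (T-KR at `p = 3`)**: PUBLISHED facts + Cremona's Manin table + `r_an = 1` +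
`3 ∤ ∏c_ℓ` + `ord_3 #Ш_an = 0` ⟹ `BSD(2304a1, 3)` (CM, `3` inert: `j = 1728`). PER PAIR; nothing booked. [cite: MatarNekovar2019, Thm. 0.3 and §0.11] -/
theorem bsdp_three_c2304a1 (hr : Records.c2304a1.analyticRank = 1)
    (htam : ¬ 3 ∣ Records.c2304a1.tamagawaProduct)
    {q : ℚ} (hq : shaAn Records.c2304a1 = (q : ℂ)) (hv : padicValRat 3 q = 0) :
    BSDp Records.c2304a1 3 :=
  have hin := cmInert_three_of_j_eq_1728 Records.c2304a1 Records.c2304a1_j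
  bsdp_three_of_mem_cremonaCurveOneX12Three_of_shaAn_unit hGZ hKo hMN hGZK hmod hnf hFH hCM8 h26 h52
    Records.c2304a1 2304 Records.mem_c2304a1
    (classX12_three_of_hasCM_of_cmInert Records.c2304a1 (hasCM_of_j_eq_1728 _ Records.c2304a1_j) hr hin)
    hin.1 htam hq hv

/-- **RECORD `2304b1 @ 3` (T-KR at `p = 3`)**: PUBLISHED facts + Cremona's Manin table + `r_an = 1` +
`3 ∤ ∏c_ℓ` + `ord_3 #Ш_an = 0` ⟹ `BSD(2304b1, 3)` (CM, `3` inert: `j = 1728`). PER PAIR; nothing booked. [cite: MatarNekovar2019, Thm. 0.3 and §0.11] -/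
theorem bsdp_three_c2304b1 (hr : Records.c2304b1.analyticRank = 1)
    (htam : ¬ 3 ∣ Records.c2304b1.tamagawaProduct)
    {q : ℚ} (hq : shaAn Records.c2304b1 = (q : ℂ)) (hv : padicValRat 3 q = 0) :
    BSDp Records.c2304b1 3 :=
  have hin := cmInert_three_of_j_eq_1728 Records.c2304b1 Records.c2304b1_j
  bsdp_three_of_mem_cremonaCurveOneX12Three_of_shaAn_unit hGZ hKo hMN hGZK hmod hnf hFH hCM8 h26 h52
    Records.c2304b1 2304 Records.mem_c2304b1
    (classX12_three_of_hasCM_of_cmInert Records.c2304b1 (hasCM_of_j_eq_1728 _ Records.c2304b1_j) hr hin)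
    hin.1 htam hq hv

/-- **RECORD `2304p1 @ 3` (T-KR at `p = 3`)**: PUBLISHED facts + Cremona's Manin table + `r_an = 1` +
`3 ∤ ∏c_ℓ` + `ord_3 #Ш_an = 0` ⟹ `BSD(2304p1, 3)` (CM, `3` inert: `j = 1728`). PER PAIR; nothing booked. [cite: MatarNekovar2019, Thm. 0.3 and §0.11] -/
theorem bsdp_three_c2304p1 (hr : Records.c2304p1.analyticRank = 1)
    (htam : ¬ 3 ∣ Records.c2304p1.tamagawaProduct)
    {q : ℚ} (hq : shaAn Records.c2304p1 = (q : ℂ)) (hv : padicValRat 3 q = 0) :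
    BSDp Records.c2304p1 3 :=
  have hin := cmInert_three_of_j_eq_1728 Records.c2304p1 Records.c2304p1_j
  bsdp_three_of_mem_cremonaCurveOneX12Three_of_shaAn_unit hGZ hKo hMN hGZK hmod hnf hFH hCM8 h26 h52
    Records.c2304p1 2304 Records.mem_c2304p1
    (classX12_three_of_hasCM_of_cmInert Records.c2304p1 (hasCM_of_j_eq_1728 _ Records.c2304p1_j) hr hin)
    hin.1 htam hq hv

/-- **RECORD `7200a1 @ 3` (T-KR at `p = 3`)**: PUBLISHED facts + Cremona's Manin table + `r_an = 1` +
`3 ∤ ∏c_ℓ` + `ord_3 #Ш_an = 0` ⟹ `BSD(7200a1, 3)` (CM, `3` inert: `j = 1728`). PER PAIR; nothing booked. [cite: MatarNekovar2019, Thm. 0.3 and §0.11] -/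
theorem bsdp_three_c7200a1 (hr : Records.c7200a1.analyticRank = 1)
    (htam : ¬ 3 ∣ Records.c7200a1.tamagawaProduct)
    {q : ℚ} (hq : shaAn Records.c7200a1 = (q : ℂ)) (hv : padicValRat 3 q = 0) :
    BSDp Records.c7200a1 3 :=
  have hin := cmInert_three_of_j_eq_1728 Records.c7200a1 Records.c7200a1_j
  bsdp_three_of_mem_cremonaCurveOneX12Three_of_shaAn_unit hGZ hKo hMN hGZK hmod hnf hFH hCM8 h26 h52
    Records.c7200a1 7200 Records.mem_c7200a1
    (classX12_three_of_hasCM_of_cmInert Records.c7200a1 (hasCM_of_j_eq_1728 _ Records.c7200a1_j) hr hin)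
    hin.1 htam hq hv

end Facts

end Summit.BirchSwinnertonDyer.Rank1Residual.X12

end
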